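import Mathlib.LinearAlgebra.FreeAlgebra
import Literature.NumberTheory.Automorphic.AutomorphicFormsTranslates
import Literature.NumberTheory.Automorphic.AdelicHeightGLProofs
import HarnessLib

/-!
# Right translates of automorphic forms by the archimedean group and by `K_∞`

Topic `NumberTheory/Automorphic`; companion of `AutomorphicFormsTranslates` (translates by elements
centralising `G_∞`). For a linear real group `H` (`𝔤 = H.lie`, `K = H.maximalCompact`), a
homomorphism `ι : H → G` and `h ∈ H`, right translation `r(h) φ = (g ↦ φ (g ι(h)))`
(`archTranslate ι h`) does **not** commute with the archimedean calculus, but is intertwined with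
it by the adjoint action: `r(h) (X φ) = (Ad h X) (r(h) φ)` (`archTranslate_lieDeriv`, tree). This
file draws the consequences (Borel–Jacquet 1979, §1.3, §1.6 and 4.3 (ii); Borel 1997, 2.16:
`r_k D f = χ(k) (ᵏX₁ ⋯ ᵏX_s) f`):

* the word action: `p (r(h) φ) = r(h) ((Ad h⁻¹ · p) φ)` for every non-commutative polynomial
  `p ∈ ℝ⟨𝔤⟩`, where `Ad h⁻¹ · p` substitutes `Ad h⁻¹ X` for each letter `X`
  (`applyFree_archTranslate`; the substitution is `FreeAlgebra.lift ℝ (ι ∘ Ad h⁻¹)`, computed on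
  the word basis by `basisFreeMonoid_eq_lift`, `applyFree_lift_comp`);
* `Ad h` induces an automorphism of `U(𝔤)` and therefore preserves its centre `Z(𝔤)` as a set, so
  substitution maps central words to central words (`isCentralWord_lift_Ad`), the `Z(𝔤)`-orbit span
  of `r(h) φ` is contained in the `r(h)`-image of that of `φ` (`zOrbitSpan_archTranslate_le`), and
  **`Z(𝔤)`-finiteness is preserved by every archimedean right translation**
  (`isZFinite_archTranslate`);
* **archimedean smoothness is preserved** (`isArchSmooth_archTranslate`): the slice of `r(h) φ`
  through `g` is the slice of `φ` through `g ι(h)` composed with the linear map `Ad h⁻¹`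
  (`exp (Ad h⁻¹ X) = h⁻¹ exp(X) h`), for a finite-dimensional coefficient algebra;
* `K`-finiteness is preserved by `K`-translations only (`isKFinite_translate`, tree) — translation by
  a general `h ∈ G_∞` yields an `h K h⁻¹`-finite function (Getz–Hahn 2024, §6.3, p. 118).

Altogether, for an automorphy datum `𝒟` and `k ∈ K_∞`:

* `IsAutomorphicForm.rightTranslation_ofK` — if the height satisfies
  `1 ⊔ ‖g k‖ ≤ C (1 ⊔ ‖g‖)`, then `r(k) φ` is an automorphic form for every automorphic form `φ`
  (same level, as `K_∞` commutes with `G(𝔸_f)`): the `K_∞`-stability of `𝒜`, second third of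
  Borel–Jacquet 1979, 4.3 (ii). For `GL_n` the height bound is `one_sup_adelicHeightGL_mul_le`
  (`AdelicHeightGLProofs`), giving `isAutomorphicForm_rightTranslation_ofK_gl`.

Everything here is proved; no definitions.

## References

* A. Borel, H. Jacquet, *Automorphic forms and automorphic representations*, Proc. Sympos. Pure
  Math. 33 (1979), part 1, §1.3, §1.6, 4.3 (ii) [BorelJacquet1979].
* A. Borel, *Automorphic forms on `SL₂(ℝ)`* (1997), 2.16 [Borel1997].
* J. R. Getz, H. Hahn, *An Introduction to Automorphic Representations* (2024), §6.3, p. 118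
  [GetzHahn2024].
-/

-- Mathlib idiom (Mathlib/Algebra/Lie/OfAssociative.lean); needed to mention Lie subalgebras of matrix algebras
attribute [local instance 100] LieRing.ofAssociativeRing

open scoped MatrixGroups Matrix ContDiff

noncomputable section

namespace Literature.NumberTheory.Automorphic

/-! ### The word basis of the free algebra -/

section FreeAlgebraWords

variable {R : Type*} [CommSemiring R] {X : Type*}

/-- The word basis vector of `ℝ⟨X⟩ = FreeAlgebra R X` attached to the word `w = [x₁, …, xₙ]` is the
monomial `ι x₁ ⋯ ι xₙ` (`FreeMonoid.lift ι w`). (Mathlib defines `FreeAlgebra.basisFreeMonoid`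
through the equivalence with the monoid algebra of the free monoid; this unfolds it.)
Dixmier, *Enveloping Algebras*, 2.1.1. [folklore] -/
theorem basisFreeMonoid_eq_lift (w : FreeMonoid X) :
    FreeAlgebra.basisFreeMonoid R X w = FreeMonoid.lift (FreeAlgebra.ι R) w := by
  simp [FreeAlgebra.basisFreeMonoid, FreeAlgebra.equivMonoidAlgebraFreeMonoid,
    MonoidAlgebra.lift_single]

/-- Substitution of letters `x ↦ f x` (the algebra endomorphism `FreeAlgebra.lift R (ι ∘ f)`) maps
the word basis vector of `w` to that of `w.map f`. [folklore] -/
theorem lift_ι_comp_basisFreeMonoid (f : X → X) (w : FreeMonoid X) :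
    FreeAlgebra.lift R (FreeAlgebra.ι R ∘ f) (FreeAlgebra.basisFreeMonoid R X w) =
      FreeAlgebra.basisFreeMonoid R X (FreeMonoid.map f w) := by
  rw [basisFreeMonoid_eq_lift, basisFreeMonoid_eq_lift]
  have key : (FreeAlgebra.lift R (FreeAlgebra.ι R ∘ f)).toMonoidHom.comp
      (FreeMonoid.lift (FreeAlgebra.ι R)) =
        (FreeMonoid.lift (FreeAlgebra.ι R)).comp (FreeMonoid.map f) :=
    FreeMonoid.hom_eq fun x => by simp
  exact DFunLike.congr_fun key w

end FreeAlgebraWords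

/-! ### The word action under archimedean right translations -/

section ArchCalculus

variable {A : Type*} [NormedCommRing A] [NormedAlgebra ℝ A] [NormedAlgebra ℚ A] [CompleteSpace A]
  [StarRing A] {N : Type*} [Fintype N] [DecidableEq N] {H : RealMatrixGroup A N}
  {G : Type*} [Group G] (ι : H.carrier →* G)

/-- Additivity of the word action in the polynomial: `(p + q) φ = p φ + q φ` (no smoothness
needed: the action is defined coefficientwise on the word basis). Borel–Jacquet 1979, §1.5–1.6. [cite: BorelJacquet1979, §1.6] -/
theorem applyFree_add (p q : FreeAlgebra ℝ H.lie) (φ : G → ℂ) :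
    applyFree ι (p + q) φ = applyFree ι p φ + applyFree ι q φ := by
  unfold applyFree
  rw [map_add, Finsupp.sum_add_index']
  · intro w
    simp
  · intro w c₁ c₂
    simp [add_smul]

/-- Homogeneity of the word action in the polynomial: `(c • p) φ = c • (p φ)` for `c ∈ ℝ`.
Borel–Jacquet 1979, §1.5–1.6. [cite: BorelJacquet1979, §1.6] -/
theorem applyFree_smul_left (c : ℝ) (p : FreeAlgebra ℝ H.lie) (φ : G → ℂ) :
    applyFree ι (c • p) φ = (c : ℂ) • applyFree ι p φ := by
  unfold applyFree
  rw [map_smul, Finsupp.sum_smul_index']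
  · rw [Finsupp.smul_sum]
    refine Finsupp.sum_congr fun w _ => ?_
    rw [smul_eq_mul, Complex.ofReal_mul, mul_smul]
  · intro w
    simp

/-- The word action of a word basis vector is the iterated Lie derivative along the word:
`(ι X₁ ⋯ ι Xₙ) φ = X₁ (⋯ (Xₙ φ))`. Borel–Jacquet 1979, §1.5. [cite: BorelJacquet1979, §1.5] -/
theorem applyFree_basisFreeMonoid (w : FreeMonoid H.lie) (φ : G → ℂ) :
    applyFree ι (FreeAlgebra.basisFreeMonoid ℝ H.lie w) φ = iterLieDeriv ι (FreeMonoid.toList w) φ := by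
  unfold applyFree
  rw [Module.Basis.repr_self, Finsupp.sum_single_index] <;> simp

/-- **The word action after substituting letters.** For a map `f : 𝔤 → 𝔤`, the polynomial
`FreeAlgebra.lift ℝ (ι ∘ f) p` (substitute `f X` for each letter `X` of `p`) acts on `φ` by
`∑_w c_w · (f X₁) (⋯ ((f Xₙ) φ))`, where `p = ∑_w c_w · X₁ ⋯ Xₙ` in the word basis.
Borel–Jacquet 1979, §1.5–1.6. [cite: BorelJacquet1979, §1.6] -/
theorem applyFree_lift_comp (f : H.lie → H.lie) (p : FreeAlgebra ℝ H.lie) (φ : G → ℂ) :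
    applyFree ι (FreeAlgebra.lift ℝ (FreeAlgebra.ι ℝ ∘ f) p) φ =
      ((FreeAlgebra.basisFreeMonoid ℝ H.lie).repr p).sum
        fun w c => (c : ℂ) • iterLieDeriv ι ((FreeMonoid.toList w).map f) φ := by
  -- `q ↦ q φ` as an `ℝ`-linear map
  let L : FreeAlgebra ℝ H.lie →ₗ[ℝ] (G → ℂ) :=
    { toFun := fun q => applyFree ι q φ
      map_add' := fun q₁ q₂ => applyFree_add ι q₁ q₂ φ
      map_smul' := fun c q => by
        rw [applyFree_smul_left, RingHom.id_apply, Complex.coe_smul] }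
  have hL : ∀ q, applyFree ι q φ = L q := fun q => rfl
  set b := FreeAlgebra.basisFreeMonoid ℝ H.lie with hb
  conv_lhs => rw [← b.linearCombination_repr p, Finsupp.linearCombination_apply, map_finsuppSum,
    hL, map_finsuppSum]
  refine Finsupp.sum_congr fun w _ => ?_
  rw [map_smul, map_smul, lift_ι_comp_basisFreeMonoid, ← hL, applyFree_basisFreeMonoid,
    FreeMonoid.toList_map, Complex.coe_smul]

/-- `Ad h⁻¹ (Ad h X) = X`. Knapp, I.§10, (1.83). [folklore] -/
@[simp]
theorem RealMatrixGroup.Ad_inv_apply_Ad (h : H.carrier) (X : H.lie) : H.Ad h⁻¹ (H.Ad h X) = X := by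
  ext1
  simp only [RealMatrixGroup.Ad_apply_coe, Subgroup.coe_inv, inv_inv]
  rw [Matrix.mul_assoc, Matrix.mul_assoc, Units.inv_mul, Matrix.mul_one, Units.inv_mul_cancel_left]

/-- `Ad h (Ad h⁻¹ X) = X`. Knapp, I.§10, (1.83). [folklore] -/
@[simp]
theorem RealMatrixGroup.Ad_apply_Ad_inv (h : H.carrier) (X : H.lie) : H.Ad h (H.Ad h⁻¹ X) = X := by
  simpa using RealMatrixGroup.Ad_inv_apply_Ad h⁻¹ X

/-- Iterated Lie derivatives of a right translate:
`X₁ ⋯ Xₙ (r(h) φ) = r(h) ((Ad h⁻¹ X₁) ⋯ (Ad h⁻¹ Xₙ) φ)` (from `archTranslate_iterLieDeriv`; no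
smoothness needed). Borel–Jacquet 1979, §1.5; Borel 1997, 2.16. [cite: BorelJacquet1979, §1.5] -/
theorem iterLieDeriv_archTranslate (h : H.carrier) (w : List H.lie) (φ : G → ℂ) :
    iterLieDeriv ι w (archTranslate ι h φ) =
      archTranslate ι h (iterLieDeriv ι (w.map (H.Ad h⁻¹)) φ) := by
  have hw : (w.map (H.Ad h⁻¹)).map (H.Ad h) = w := by
    rw [List.map_map]
    conv_rhs => rw [← List.map_id w]
    refine List.map_congr_left fun X _ => ?_
    simp
  rw [archTranslate_iterLieDeriv, hw]

/-- **The word action on a right translate**: `p (r(h) φ) = r(h) ((Ad h⁻¹ · p) φ)`, where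
`Ad h⁻¹ · p = FreeAlgebra.lift ℝ (ι ∘ Ad h⁻¹) p` substitutes `Ad h⁻¹ X` for each letter `X`
(no smoothness needed). Borel–Jacquet 1979, §1.5–1.6; Borel 1997, 2.16. [cite: BorelJacquet1979, §1.6] -/
theorem applyFree_archTranslate (h : H.carrier) (p : FreeAlgebra ℝ H.lie) (φ : G → ℂ) :
    applyFree ι p (archTranslate ι h φ) =
      archTranslate ι h (applyFree ι (FreeAlgebra.lift ℝ (FreeAlgebra.ι ℝ ∘ H.Ad h⁻¹) p) φ) := by
  rw [applyFree_lift_comp, map_finsuppSum]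
  unfold applyFree
  refine Finsupp.sum_congr fun w _ => ?_
  rw [map_smul, iterLieDeriv_archTranslate]

/-! ### `Ad` preserves the centre of `U(𝔤)`; `Z(𝔤)`-finiteness of translates -/

/-- `Ad h` on `U(𝔤)` (the algebra endomorphism `U(Ad h)`) is inverse to `U(Ad h⁻¹)`. [folklore] -/
theorem envelopingAd_comp_inv (h : H.carrier) :
    (UniversalEnvelopingAlgebra.lift ℝ
        ((UniversalEnvelopingAlgebra.ι ℝ).comp (H.Ad h : H.lie →ₗ⁅ℝ⁆ H.lie))).comp
      (UniversalEnvelopingAlgebra.lift ℝ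
        ((UniversalEnvelopingAlgebra.ι ℝ).comp (H.Ad h⁻¹ : H.lie →ₗ⁅ℝ⁆ H.lie))) =
      AlgHom.id ℝ (UniversalEnvelopingAlgebra ℝ H.lie) := by
  refine UniversalEnvelopingAlgebra.hom_ext (h := LieHom.ext fun X => ?_)
  simp

/-- **Substitution by `Ad h` on words covers `U(Ad h)` on `U(𝔤)`**:
`freeToEnveloping (Ad h · p) = U(Ad h) (freeToEnveloping p)`. [folklore] -/
theorem freeToEnveloping_lift_Ad (h : H.carrier) (p : FreeAlgebra ℝ H.lie) :
    freeToEnveloping H (FreeAlgebra.lift ℝ (FreeAlgebra.ι ℝ ∘ H.Ad h) p) =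
      UniversalEnvelopingAlgebra.lift ℝ
        ((UniversalEnvelopingAlgebra.ι ℝ).comp (H.Ad h : H.lie →ₗ⁅ℝ⁆ H.lie))
        (freeToEnveloping H p) := by
  change ((freeToEnveloping H).comp (FreeAlgebra.lift ℝ (FreeAlgebra.ι ℝ ∘ H.Ad h))) p =
    ((UniversalEnvelopingAlgebra.lift ℝ
      ((UniversalEnvelopingAlgebra.ι ℝ).comp (H.Ad h : H.lie →ₗ⁅ℝ⁆ H.lie))).comp
        (freeToEnveloping H)) p
  congr 1
  refine FreeAlgebra.hom_ext ?_
  funext X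
  simp [freeToEnveloping]

/-- **`Ad h` maps central words to central words**: an algebra automorphism of `U(𝔤)` preserves
the centre `Z(𝔤)` (as a set). Borel–Jacquet 1979, §1.6; Borel 1997, 2.16. [cite: BorelJacquet1979, §1.6] -/
theorem isCentralWord_lift_Ad (h : H.carrier) {p : FreeAlgebra ℝ H.lie} (hp : IsCentralWord p) :
    IsCentralWord (FreeAlgebra.lift ℝ (FreeAlgebra.ι ℝ ∘ H.Ad h) p) := by
  unfold IsCentralWord at hp ⊢
  rw [freeToEnveloping_lift_Ad]
  set Uh := UniversalEnvelopingAlgebra.lift ℝ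
    ((UniversalEnvelopingAlgebra.ι ℝ).comp (H.Ad h : H.lie →ₗ⁅ℝ⁆ H.lie)) with hUh
  set Uh' := UniversalEnvelopingAlgebra.lift ℝ
    ((UniversalEnvelopingAlgebra.ι ℝ).comp (H.Ad h⁻¹ : H.lie →ₗ⁅ℝ⁆ H.lie)) with hUh'
  have hinv : ∀ y, Uh (Uh' y) = y := fun y => by
    change (Uh.comp Uh') y = y
    rw [hUh, hUh', envelopingAd_comp_inv]
    rfl
  rw [Subalgebra.mem_center_iff] at hp ⊢
  intro y
  rw [← hinv y, ← map_mul, hp (Uh' y), map_mul]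

/-- **The `Z(𝔤)`-orbit span of a right translate** `r(h) φ` is contained in the `r(h)`-image of
the `Z(𝔤)`-orbit span of `φ` (`z (r(h) φ) = r(h) ((Ad h⁻¹ z) φ)` with `Ad h⁻¹ z` central).
Borel–Jacquet 1979, §1.6 and 4.3 (ii). [cite: BorelJacquet1979, 4.3 (ii)] -/
theorem zOrbitSpan_archTranslate_le (h : H.carrier) (φ : G → ℂ) :
    zOrbitSpan ι (archTranslate ι h φ) ≤ (zOrbitSpan ι φ).map (archTranslate ι h) := by
  refine Submodule.span_le.mpr ?_
  rintro _ ⟨p, hp, rfl⟩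
  rw [SetLike.mem_coe, applyFree_archTranslate]
  exact Submodule.mem_map_of_mem (Submodule.subset_span ⟨_, isCentralWord_lift_Ad h⁻¹ hp, rfl⟩)

/-- **`Z(𝔤)`-finiteness is preserved by archimedean right translations** `r(h)`, `h ∈ G_∞`.
Borel–Jacquet 1979, §1.6 and 4.3 (ii). [cite: BorelJacquet1979, 4.3 (ii)] -/
theorem isZFinite_archTranslate (h : H.carrier) {φ : G → ℂ} (hφ : IsZFinite ι φ) :
    IsZFinite ι (archTranslate ι h φ) := by
  unfold IsZFinite at hφ ⊢
  exact Submodule.finiteDimensional_of_le (zOrbitSpan_archTranslate_le ι h φ)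

/-! ### Smoothness of translates -/

/-- `exp(X) h = h exp(Ad h⁻¹ X)` in `H` (`Matrix.exp_units_conj'`). Knapp, I.§10, Prop. 1.89. [folklore] -/
theorem expMem_mul_eq_mul_expMem_Ad_inv (h : H.carrier) (X : H.lie) :
    H.expMem X * h = h * H.expMem (H.Ad h⁻¹ X) := by
  refine Subtype.ext (Units.ext ?_)
  change NormedSpace.exp (X : Matrix N N A) * ((h : GL N A) : Matrix N N A) =
    ((h : GL N A) : Matrix N N A) *
      NormedSpace.exp ((((h⁻¹ : H.carrier) : GL N A) : Matrix N N A) * (X : Matrix N N A) *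
        ((((h⁻¹ : H.carrier) : GL N A)⁻¹ : GL N A) : Matrix N N A))
  rw [Subgroup.coe_inv, inv_inv, Matrix.exp_units_conj', ← Matrix.mul_assoc, ← Matrix.mul_assoc,
    Units.mul_inv, Matrix.one_mul]

open scoped Matrix.Norms.Operator in
/-- **Archimedean smoothness is preserved by archimedean right translations** (finite-dimensional
coefficients): the slice `X ↦ (r(h) φ)(g exp X) = φ (g ι(h) exp (Ad h⁻¹ X))` is the slice of `φ`
through `g ι(h)` composed with the linear map `Ad h⁻¹`. Borel–Jacquet 1979, §1.1 and 4.3 (ii). [cite: BorelJacquet1979, 4.3 (ii)] -/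
theorem isArchSmooth_archTranslate [FiniteDimensional ℝ A] (h : H.carrier) {φ : G → ℂ}
    (hφ : IsArchSmooth ι φ) : IsArchSmooth ι (archTranslate ι h φ) := by
  intro g
  -- the linear map `Ad h⁻¹` on the normed space `𝔤`
  let L : H.lie.toSubmodule →ₗ[ℝ] H.lie.toSubmodule :=
    { toFun := fun X => ⟨(H.Ad h⁻¹ ⟨X, X.2⟩ : H.lie), (H.Ad h⁻¹ ⟨X, X.2⟩).2⟩
      map_add' := fun X Y => by
        ext1
        change ((H.Ad h⁻¹ (⟨X, X.2⟩ + ⟨Y, Y.2⟩) : H.lie) : Matrix N N A) = _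
        rw [map_add]
        rfl
      map_smul' := fun c X => by
        ext1
        change ((H.Ad h⁻¹ (c • ⟨X, X.2⟩) : H.lie) : Matrix N N A) = _
        rw [map_smul]
        rfl }
  haveI : FiniteDimensional ℝ H.lie.toSubmodule := inferInstance
  have hLsmooth : ContDiff ℝ ∞ (L : H.lie.toSubmodule → H.lie.toSubmodule) := by
    exact (⟨L, L.continuous_of_finiteDimensional⟩ :
      H.lie.toSubmodule →L[ℝ] H.lie.toSubmodule).contDiff
  have heq : (fun X : H.lie.toSubmodule => archTranslate ι h φ (g * ι (H.expMem ⟨X, X.2⟩))) =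
      (fun Y : H.lie.toSubmodule => φ (g * ι h * ι (H.expMem ⟨Y, Y.2⟩))) ∘ (L : _ → _) := by
    funext X
    simp only [Function.comp_apply]
    rw [archTranslate_apply, mul_assoc, ← map_mul, expMem_mul_eq_mul_expMem_Ad_inv, map_mul,
      ← mul_assoc]
    rfl
  rw [heq]
  exact (hφ (g * ι h)).comp hLsmooth

end ArchCalculus

/-! ### Automorphic forms: translates by `K_∞` -/

section Datum

variable {K : Type} [Field K] [NumberField K]
  {A : Type*} [NormedCommRing A] [NormedAlgebra ℝ A] [NormedAlgebra ℚ A] [CompleteSpace A]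
  [StarRing A] {N : Type*} [Fintype N] [DecidableEq N]
  {𝒢 : AdelicGroupData K} {𝒟 : AutomorphyDatum 𝒢 A N}

/-- **`K_∞`-translates of automorphic forms are automorphic forms** (Borel–Jacquet 1979, 4.3 (ii):
`𝒜` is `K_∞`-stable), for a datum over a finite-dimensional coefficient algebra whose height
satisfies `1 ⊔ ‖g k‖ ≤ C (1 ⊔ ‖g‖)`: `r(k) φ = (g ↦ φ (g k))` keeps the left `G(K)`-invariance and
the level (`K_∞` centralises `G(𝔸_f)`), is smooth (`isArchSmooth_archTranslate`), `K_∞`-finite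
(`isKFinite_translate`) and `Z(𝔤)`-finite (`isZFinite_archTranslate`), and has moderate growth
(`HasModerateGrowth.rightTranslation`). [cite: BorelJacquet1979, 4.3 (ii)] -/
theorem IsAutomorphicForm.rightTranslation_ofK [FiniteDimensional ℝ A] {φ : 𝒢.Adelic → ℂ}
    (hφ : IsAutomorphicForm 𝒟 φ) (k : 𝒟.arch.maximalCompact) {C : ℝ}
    (hC : ∀ g, 1 ⊔ 𝒟.height (g * 𝒟.ofK k) ≤ C * (1 ⊔ 𝒟.height g)) :
    IsAutomorphicForm 𝒟 (rightTranslation 𝒢 (𝒟.ofK k) φ) where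
  leftInvariant := hφ.leftInvariant.rightTranslation _
  exists_level := by
    obtain ⟨U, hU, hφU⟩ := hφ.exists_level
    refine ⟨U, hU, hφU.rightTranslation fun u hu => ?_⟩
    rw [𝒟.ofK_apply, mul_assoc, ← 𝒟.commute_ofArch _ u (𝒟.le_finiteAdelic U hU hu), ← mul_assoc,
      inv_mul_cancel, one_mul]
    exact hu
  archSmooth := by
    rw [← 𝒟.archTranslate_ofK]
    exact isArchSmooth_archTranslate 𝒟.ofArch _ hφ.archSmooth
  kFinite := by
    rw [← 𝒟.archTranslate_ofK]
    exact isKFinite_translate k hφ.kFinite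
  zFinite := by
    rw [← 𝒟.archTranslate_ofK]
    exact isZFinite_archTranslate 𝒟.ofArch _ hφ.zFinite
  moderateGrowth := hφ.moderateGrowth.rightTranslation hC

end Datum

/-! ### `GL_n`: the height bound is free -/

section GLn

open scoped Classical
open NumberField NumberField.mixedEmbedding IsDedekindDomain

variable {n : ℕ} {K : Type} [Field K] [NumberField K] {hcpt : isCompact_glFiniteIntegralLevel n K}

/-- **`K_∞`-translates of automorphic forms on `GL_n(𝔸_K)` are automorphic forms**
(Borel–Jacquet 1979, 4.3 (ii); Getz–Hahn 2024, (6.7)): the height bound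
`1 ⊔ ‖g k‖ ≤ (1 ⊔ n ‖k‖) (1 ⊔ ‖g‖)` is `one_sup_adelicHeightGL_mul_le`. [cite: BorelJacquet1979, 4.3 (ii)] -/
theorem isAutomorphicForm_rightTranslation_ofK_gl {φ : (AdelicGroupData.gl n K).Adelic → ℂ}
    (hφ : IsAutomorphicForm (AutomorphyDatum.gl n K hcpt) φ)
    (k : (AutomorphyDatum.gl n K hcpt).arch.maximalCompact) :
    IsAutomorphicForm (AutomorphyDatum.gl n K hcpt)
      (rightTranslation (AdelicGroupData.gl n K) ((AutomorphyDatum.gl n K hcpt).ofK k) φ) :=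
  hφ.rightTranslation_ofK k
    (C := 1 ⊔ n * adelicHeightGL n K ((AutomorphyDatum.gl n K hcpt).ofK k)) fun g =>
    one_sup_adelicHeightGL_mul_le g _

end GLn

end Literature.NumberTheory.Automorphic
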